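import Mathlib.Analysis.SpecialFunctions.Pow.Continuity
import Mathlib.Analysis.Complex.Basic
import HarnessLib

/-!
# K2 · E4 helper — germ functions `t ↦ ‖t‖^{-a} χ(t)` with distinct `(a, χ)` are linearly independent near `0` (uniqueness of germ expansions)

`Summits/HodgeConjecture/HodgeConjecture/Theorems/K2E4GermFunctionsLinearIndependent.lean` (HCML Track B «K2-LIT», chair K2-lead, dealer K2E4-plan DEAL 21:26:21Z;
seat K2E4-p03).  FRAME-FREE real∕`p`-adic analysis over any nontrivially normed field `K` (e.g. a local field `L_w`), for unitary characters `χ : Kˣ →* ℂ`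
(`‖χ u‖ = 1`).  The uniqueness statement behind the comparison of Shalika-germ expansions [Rogawski1990 §8.1 (8.1.1)–(8.1.2) p. 117, Prop. 8.1.3 p. 116:
the singular terms `|t|^{-a} χ(t)` of the expansion of `Φ^κ(γδ_t, f)` and the constant term `d Σ_j (−1)^{q(I(j))} κ(…) Φ(j(γ), f)` are read off UNIQUELY] —
K2E4-p05's unblock item 3 for the germ kernel socket `sig_K2E3GermConstantStableSheets`, serving sockets #3∕#5∕#7R∕#8 and K2E3's U3:

* `eq_zero_of_tendsto_sum_character` — DISTINCT UNITARY CHARACTERS ARE LINEARLY INDEPENDENT UNDER A LIMIT: on any group `G`, along any non-trivial filter `F`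
  invariant under left translations, `Σ_{χ∈S} c_χ χ(t) → 0` forces `c_χ = 0` (Artin–Dedekind: translate by `g` with `χ₁(g) ≠ χ₂(g)` and induct on `S`).
* `eq_zero_of_eventually_sum_rpow_mul_character_eq_zero` — MAIN: for a finset `S` of DISTINCT pairs `(a, χ)` (ANY real exponents) and coefficients `c`, if
  `Σ_{(a,χ)∈S} c(a,χ) ‖t‖^{-a} χ(t) = 0` eventually as `t → 0`, `t ≠ 0`, then `c ≡ 0` on `S` (growth-rate induction on the top exponent layer: multiply by `‖t‖^{A}`,
  the lower layers tend to `0`, the top layer is a combination of distinct characters tending to `0`).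
* `germFunctions_linearIndependent` — the dealer's wording: `c₀ + Σ_{(a,χ)∈S} c(a,χ) ‖t‖^{-a} χ(t) = 0` for `0 < ‖t‖ < δ` with all `a > 0` ⇒ `c₀ = 0` and `c ≡ 0` on `S`.

HONEST LABEL: HC_CM is proved only modulo the 7 printed citations (2 remaining named inputs: hLiu418 = stmt-HodgeConjecture-24832, h413 = stmt-HodgeConjecture-24833)
until rung 0 closes.  Pure Mathlib; sorry-free; no `def`, no instance, no notation.

## References
* [Rogawski1990] J. D. Rogawski, *Automorphic Representations of Unitary Groups in Three Variables*, Ann. of Math. Stud. 123 (1990): §8.1 (8.1.1)–(8.1.2) p. 117, Prop. 8.1.3 p. 116.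
* [Lang2002] S. Lang, *Algebra*, 3rd ed., GTM 211 (2002): Ch. VI §4, Thm. 4.1 (Artin: independence of characters).
-/

set_option autoImplicit false
set_option linter.dupNamespace false

noncomputable section

open Filter Topology

namespace Summit.HodgeConjecture.HodgeConjecture.Cruxes.H413.K2E4GermFunctionsLinearIndependent

/-! ## §1 Distinct unitary characters are linearly independent under a limit -/

section Characters

variable {G : Type*} [Group G]

/-- **ARTIN–DEDEKIND UNDER A LIMIT.**  `G` a group, `F` a non-trivial filter on `G` invariant under every left translation (`t ↦ g t` maps `F` into `F`), `S` a finite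
set of characters `χ : G →* ℂ` that are UNITARY (`‖χ t‖ = 1`), `c` coefficients.  If `Σ_{χ ∈ S} c_χ χ(t) → 0` along `F`, then `c_χ = 0` for every `χ ∈ S`.
(Induction on `S`: a single unitary character has constant modulus; for two distinct `χ₁ ≠ χ₂ ∈ S` pick `g` with `χ₁(g) ≠ χ₂(g)`, then
`H(gt) − χ₂(g)H(t) = Σ_{χ ≠ χ₂} c_χ (χ(g) − χ₂(g)) χ(t) → 0` has fewer characters and a non-zero multiple of `c_{χ₁}` as its `χ₁`-coefficient.)
[cite: Lang2002, Ch. VI §4 Thm. 4.1] [cite: Rogawski1990, §8.1 Prop. 8.1.3 p. 116] -/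
theorem eq_zero_of_tendsto_sum_character {F : Filter G} [F.NeBot] (hF : ∀ g : G, Tendsto (fun t => g * t) F F)
    (S : Finset (G →* ℂ)) (hS : ∀ χ ∈ S, ∀ t, ‖χ t‖ = 1) (c : (G →* ℂ) → ℂ)
    (h : Tendsto (fun t => ∑ χ ∈ S, c χ * χ t) F (𝓝 0)) : ∀ χ ∈ S, c χ = 0 := by
  classical
  induction S using Finset.strongInduction generalizing c with
  | H S ih =>
  intro χ₁ hχ₁
  by_cases hex : ∃ χ₂ ∈ S, χ₂ ≠ χ₁
  · obtain ⟨χ₂, hχ₂, hne⟩ := hex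
    obtain ⟨g, hg⟩ : ∃ g : G, χ₁ g ≠ χ₂ g := by
      by_contra hall
      push Not at hall
      exact hne (MonoidHom.ext fun x => (hall x).symm)
    -- the translated combination with `χ₂` eliminated
    have key : ∀ t, ∑ χ ∈ S.erase χ₂, (c χ * (χ g - χ₂ g)) * χ t = (∑ χ ∈ S, c χ * χ (g * t)) - χ₂ g * ∑ χ ∈ S, c χ * χ t := by
      intro t
      rw [Finset.sum_erase S (by simp : (c χ₂ * (χ₂ g - χ₂ g)) * χ₂ t = 0), Finset.mul_sum, ← Finset.sum_sub_distrib]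
      refine Finset.sum_congr rfl fun χ _ => ?_
      rw [map_mul]
      ring
    have hlim : Tendsto (fun t => (∑ χ ∈ S, c χ * χ (g * t)) - χ₂ g * ∑ χ ∈ S, c χ * χ t) F (𝓝 0) := by
      simpa using ((h.comp (hF g)).sub (h.const_mul (χ₂ g)))
    have h' : Tendsto (fun t => ∑ χ ∈ S.erase χ₂, (c χ * (χ g - χ₂ g)) * χ t) F (𝓝 0) :=
      hlim.congr' (Eventually.of_forall fun t => (key t).symm)
    have hz := ih (S.erase χ₂) (Finset.erase_ssubset hχ₂) (fun χ hχ t => hS χ (Finset.mem_of_mem_erase hχ) t)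
      (fun χ => c χ * (χ g - χ₂ g)) h' χ₁ (Finset.mem_erase.2 ⟨hne.symm, hχ₁⟩)
    exact (mul_eq_zero.1 hz).resolve_right (sub_ne_zero.2 hg)
  · -- `S = {χ₁}`: a single unitary character has constant modulus `‖c χ₁‖`
    push Not at hex
    have hS1 : S = {χ₁} := Finset.eq_singleton_iff_unique_mem.2 ⟨hχ₁, hex⟩
    rw [hS1] at h
    simp only [Finset.sum_singleton] at h
    have hnorm : Tendsto (fun t => ‖c χ₁ * χ₁ t‖) F (𝓝 ‖c χ₁‖) := by
      have : (fun t => ‖c χ₁ * χ₁ t‖) = fun _ => ‖c χ₁‖ := by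
        funext t
        rw [norm_mul, hS χ₁ hχ₁ t, mul_one]
      rw [this]
      exact tendsto_const_nhds
    have h0 : Tendsto (fun t => ‖c χ₁ * χ₁ t‖) F (𝓝 0) := by simpa using h.norm
    exact norm_eq_zero.1 (tendsto_nhds_unique hnorm h0)

end Characters

/-! ## §2 Germ functions `‖t‖^{-a} χ(t)` near `0` in a nontrivially normed field -/

section Germs

variable {K : Type*} [NontriviallyNormedField K]

/-- The punctured neighbourhood filter of `0`, pulled back to `Kˣ`, is non-trivial (a nontrivially normed field has non-zero elements arbitrarily close to `0`).
[cite: Lang2002, Ch. XII §1] -/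
theorem neBot_comap_units_nhdsNE_zero : (comap ((↑) : Kˣ → K) (𝓝[≠] (0 : K))).NeBot := by
  refine comap_neBot fun s hs => ?_
  obtain ⟨x, hxs, hx0⟩ := Filter.nonempty_of_mem (inter_mem hs self_mem_nhdsWithin)
  exact ⟨Units.mk0 x hx0, hxs⟩

/-- The punctured filter at `0` on `Kˣ` is invariant under multiplication by any `g ∈ Kˣ` (dilations fix `0` and are homeomorphisms). [cite: Lang2002, Ch. XII §1] -/
theorem tendsto_mul_left_comap_units_nhdsNE_zero (g : Kˣ) :
    Tendsto (fun t : Kˣ => g * t) (comap ((↑) : Kˣ → K) (𝓝[≠] (0 : K))) (comap ((↑) : Kˣ → K) (𝓝[≠] (0 : K))) := by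
  have hK : Tendsto (fun x : K => (g : K) * x) (𝓝[≠] (0 : K)) (𝓝[≠] (0 : K)) := by
    refine tendsto_nhdsWithin_iff.2 ⟨?_, ?_⟩
    · have hc : Tendsto (fun x : K => (g : K) * x) (𝓝 (0 : K)) (𝓝 ((g : K) * 0)) := (continuous_const_mul (g : K)).tendsto 0
      rw [mul_zero] at hc
      exact hc.mono_left nhdsWithin_le_nhds
    · filter_upwards [self_mem_nhdsWithin] with x hx
      exact mul_ne_zero g.ne_zero hx
  refine tendsto_comap_iff.2 ?_
  have e : ((↑) : Kˣ → K) ∘ (fun t : Kˣ => g * t) = fun t : Kˣ => (g : K) * (t : K) := by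
    funext t
    simp
  rw [e]
  exact hK.comp tendsto_comap

/-- Along the punctured filter at `0` on `Kˣ`, `‖t‖ → 0`. [cite: Lang2002, Ch. XII §1] -/
theorem tendsto_norm_comap_units_nhdsNE_zero :
    Tendsto (fun t : Kˣ => ‖(t : K)‖) (comap ((↑) : Kˣ → K) (𝓝[≠] (0 : K))) (𝓝 0) := by
  have h : Tendsto ((↑) : Kˣ → K) (comap ((↑) : Kˣ → K) (𝓝[≠] (0 : K))) (𝓝 0) := tendsto_comap.mono_right nhdsWithin_le_nhds
  simpa using h.norm

/-- **MAIN — UNIQUENESS OF GERM EXPANSIONS.**  `K` a nontrivially normed field, `S` a finite set of DISTINCT pairs `(a, χ)` with `a ∈ ℝ` (any sign) and `χ : Kˣ →* ℂ`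
a UNITARY character, `c` coefficients.  If `Σ_{(a,χ) ∈ S} c(a,χ) · ‖t‖^{−a} · χ(t) = 0` for all `t ≠ 0` sufficiently close to `0` (eventually along the punctured filter),
then `c(a,χ) = 0` for every `(a,χ) ∈ S`.  (Growth-rate induction: with `A` the largest exponent in `S`, multiply by `‖t‖^{A}`; the layers `a < A` carry
`‖t‖^{A−a} → 0`, so the top layer `Σ_{(A,χ)∈S} c(A,χ) χ(t) → 0` — a combination of DISTINCT unitary characters, killed by §1; then recurse on the rest.)
[cite: Rogawski1990, §8.1 (8.1.1)–(8.1.2) p. 117; Prop. 8.1.3 p. 116] [cite: Lang2002, Ch. VI §4 Thm. 4.1] -/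
theorem eq_zero_of_eventually_sum_rpow_mul_character_eq_zero (S : Finset (ℝ × (Kˣ →* ℂ))) (hS : ∀ p ∈ S, ∀ u, ‖p.2 u‖ = 1)
    (c : ℝ × (Kˣ →* ℂ) → ℂ)
    (h : ∀ᶠ t : Kˣ in comap ((↑) : Kˣ → K) (𝓝[≠] (0 : K)), ∑ p ∈ S, c p * (((‖(t : K)‖ ^ (-p.1) : ℝ)) : ℂ) * p.2 t = 0) :
    ∀ p ∈ S, c p = 0 := by
  classical
  haveI := (neBot_comap_units_nhdsNE_zero (K := K))
  induction S using Finset.strongInduction with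
  | H S ih =>
  rcases S.eq_empty_or_nonempty with hSe | hne
  · simp [hSe]
  -- the top exponent `A`, the top layer `T` and the rest `R`
  set A : ℝ := S.sup' hne Prod.fst with hAdef
  have hle : ∀ p ∈ S, p.1 ≤ A := fun p hp => Finset.le_sup' Prod.fst hp
  set T := S.filter (fun p => p.1 = A) with hTdef
  set R := S.filter (fun p => ¬ p.1 = A) with hRdef
  have hTne : T.Nonempty := by
    obtain ⟨p, hp, hpA⟩ := Finset.exists_mem_eq_sup' hne Prod.fst
    exact ⟨p, Finset.mem_filter.2 ⟨hp, hpA.symm⟩⟩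
  have hRS : R ⊂ S := by
    refine Finset.filter_ssubset.2 ?_
    obtain ⟨p, hp⟩ := hTne
    exact ⟨p, (Finset.mem_filter.1 hp).1, fun hn => hn (Finset.mem_filter.1 hp).2⟩
  have hpos : ∀ t : Kˣ, 0 < ‖(t : K)‖ := fun t => norm_pos_iff.2 t.ne_zero
  -- (1) multiply by `‖t‖^A`: `Σ_{p∈S} c p ‖t‖^{A − p.1} χ_p(t) = 0` eventually
  have h1 : ∀ᶠ t : Kˣ in comap ((↑) : Kˣ → K) (𝓝[≠] (0 : K)), ∑ p ∈ S, c p * (((‖(t : K)‖ ^ (A - p.1) : ℝ)) : ℂ) * p.2 t = 0 := by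
    filter_upwards [h] with t ht
    have e : ∀ p ∈ S, c p * (((‖(t : K)‖ ^ (A - p.1) : ℝ)) : ℂ) * p.2 t = (((‖(t : K)‖ ^ A : ℝ)) : ℂ) * (c p * (((‖(t : K)‖ ^ (-p.1) : ℝ)) : ℂ) * p.2 t) := by
      intro p _
      rw [sub_eq_add_neg, Real.rpow_add (hpos t), Complex.ofReal_mul]
      ring
    rw [Finset.sum_congr rfl e, ← Finset.mul_sum, ht, mul_zero]
  -- (2) split into the top layer (`‖t‖^{0} = 1`) and the rest
  have h2 : ∀ᶠ t : Kˣ in comap ((↑) : Kˣ → K) (𝓝[≠] (0 : K)),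
      ∑ p ∈ T, c p * p.2 t = -∑ p ∈ R, c p * (((‖(t : K)‖ ^ (A - p.1) : ℝ)) : ℂ) * p.2 t := by
    filter_upwards [h1] with t ht
    rw [← Finset.sum_filter_add_sum_filter_not S (fun p => p.1 = A)] at ht
    have eT : ∑ p ∈ T, c p * (((‖(t : K)‖ ^ (A - p.1) : ℝ)) : ℂ) * p.2 t = ∑ p ∈ T, c p * p.2 t := by
      refine Finset.sum_congr rfl fun p hp => ?_
      rw [(Finset.mem_filter.1 hp).2, sub_self, Real.rpow_zero, Complex.ofReal_one, mul_one]
    rw [eT] at ht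
    exact eq_neg_of_add_eq_zero_left ht
  -- (3) the rest tends to `0` (each term carries `‖t‖^{A − a}` with `A − a > 0`)
  have h3 : Tendsto (fun t : Kˣ => ∑ p ∈ R, c p * (((‖(t : K)‖ ^ (A - p.1) : ℝ)) : ℂ) * p.2 t)
      (comap ((↑) : Kˣ → K) (𝓝[≠] (0 : K))) (𝓝 0) := by
    have h0 : ∀ p ∈ R, Tendsto (fun t : Kˣ => c p * (((‖(t : K)‖ ^ (A - p.1) : ℝ)) : ℂ) * p.2 t)
        (comap ((↑) : Kˣ → K) (𝓝[≠] (0 : K))) (𝓝 0) := by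
      intro p hp
      have hpS : p ∈ S := (Finset.mem_filter.1 hp).1
      have hb : 0 < A - p.1 := sub_pos.2 (lt_of_le_of_ne (hle p hpS) (Finset.mem_filter.1 hp).2)
      have hr : Tendsto (fun t : Kˣ => ‖(t : K)‖ ^ (A - p.1)) (comap ((↑) : Kˣ → K) (𝓝[≠] (0 : K))) (𝓝 0) := by
        have hc := (Real.continuousAt_rpow_const 0 (A - p.1) (Or.inr hb.le)).tendsto
        rw [Real.zero_rpow hb.ne'] at hc
        exact hc.comp tendsto_norm_comap_units_nhdsNE_zero
      refine tendsto_zero_iff_norm_tendsto_zero.2 ?_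
      have e : (fun t : Kˣ => ‖c p * (((‖(t : K)‖ ^ (A - p.1) : ℝ)) : ℂ) * p.2 t‖) = fun t : Kˣ => ‖c p‖ * ‖(t : K)‖ ^ (A - p.1) := by
        funext t
        rw [norm_mul, norm_mul, hS p hpS t, mul_one, Complex.norm_real, Real.norm_of_nonneg (Real.rpow_nonneg (norm_nonneg _) _)]
      rw [e]
      simpa using hr.const_mul ‖c p‖
    simpa using tendsto_finsetSum R h0
  -- (4) so the top layer, a combination of DISTINCT unitary characters, tends to `0`
  have h4 : Tendsto (fun t : Kˣ => ∑ p ∈ T, c p * p.2 t) (comap ((↑) : Kˣ → K) (𝓝[≠] (0 : K))) (𝓝 0) := by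
    have := h3.neg
    rw [neg_zero] at this
    exact this.congr' (h2.mono fun t ht => ht.symm)
  -- (5) re-index the top layer by its characters (injective on `T`) and apply §1
  have hinj : Set.InjOn (Prod.snd : ℝ × (Kˣ →* ℂ) → (Kˣ →* ℂ)) T := by
    intro p hp q hq hpq
    exact Prod.ext (((Finset.mem_coe.1 hp |> Finset.mem_filter.1).2).trans ((Finset.mem_coe.1 hq |> Finset.mem_filter.1).2).symm) hpq
  have h5 : Tendsto (fun t : Kˣ => ∑ χ ∈ T.image Prod.snd, c (A, χ) * χ t) (comap ((↑) : Kˣ → K) (𝓝[≠] (0 : K))) (𝓝 0) := by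
    refine h4.congr' (Eventually.of_forall fun t => ?_)
    show ∑ p ∈ T, c p * p.2 t = ∑ χ ∈ T.image Prod.snd, c (A, χ) * χ t
    rw [Finset.sum_image hinj]
    refine Finset.sum_congr rfl fun p hp => ?_
    rw [show (A, p.2) = p from Prod.ext ((Finset.mem_filter.1 hp).2).symm rfl]
  have hT0 : ∀ p ∈ T, c p = 0 := by
    intro p hp
    have hz := eq_zero_of_tendsto_sum_character (tendsto_mul_left_comap_units_nhdsNE_zero (K := K)) (T.image Prod.snd)
      (fun χ hχ u => by
        obtain ⟨q, hq, rfl⟩ := Finset.mem_image.1 hχ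
        exact hS q (Finset.mem_filter.1 hq).1 u)
      (fun χ => c (A, χ)) h5 p.2 (Finset.mem_image_of_mem _ hp)
    rwa [show (A, p.2) = p from Prod.ext ((Finset.mem_filter.1 hp).2).symm rfl] at hz
  -- (6) the top coefficients vanish, so the rest satisfies the hypothesis: recurse
  have h6 : ∀ᶠ t : Kˣ in comap ((↑) : Kˣ → K) (𝓝[≠] (0 : K)), ∑ p ∈ R, c p * (((‖(t : K)‖ ^ (-p.1) : ℝ)) : ℂ) * p.2 t = 0 := by
    filter_upwards [h] with t ht
    rw [← Finset.sum_filter_add_sum_filter_not S (fun p => p.1 = A)] at ht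
    have eT : ∑ p ∈ T, c p * (((‖(t : K)‖ ^ (-p.1) : ℝ)) : ℂ) * p.2 t = 0 :=
      Finset.sum_eq_zero fun p hp => by rw [hT0 p hp, zero_mul, zero_mul]
    rwa [eT, zero_add] at ht
  have hR0 := ih R hRS (fun p hp => hS p (Finset.mem_filter.1 hp).1) h6
  intro p hp
  by_cases hpA : p.1 = A
  · exact hT0 p (Finset.mem_filter.2 ⟨hp, hpA⟩)
  · exact hR0 p (Finset.mem_filter.2 ⟨hp, hpA⟩)

/-- **GERM FUNCTIONS ARE LINEARLY INDEPENDENT (the dealer's wording).**  `K` a nontrivially normed field; `S` a finite set of DISTINCT pairs `(a, χ)` with `a > 0` and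
`χ : Kˣ →* ℂ` unitary; `c₀`, `c` coefficients; `δ > 0`.  If `c₀ + Σ_{(a,χ) ∈ S} c(a,χ) · ‖t‖^{−a} · χ(t) = 0` for every `t ≠ 0` with `‖t‖ < δ`, then `c₀ = 0` and
`c(a,χ) = 0` for all `(a,χ) ∈ S` — «a constant plus a finite ℂ-combination of `t ↦ |t|_v^{−a}·χ(t)` (`a > 0`, `χ` unitary, distinct `(a,χ)`) that vanishes for all
sufficiently small `t ≠ 0` has zero constant (indeed all coefficients zero)».  (The constant is the pair `(0, 1)`, distinct from the others since their exponents are positive.)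
[cite: Rogawski1990, §8.1 (8.1.1)–(8.1.2) p. 117; Prop. 8.1.3 p. 116] [cite: Lang2002, Ch. VI §4 Thm. 4.1] -/
theorem germFunctions_linearIndependent (S : Finset (ℝ × (Kˣ →* ℂ))) (hS : ∀ p ∈ S, ∀ u, ‖p.2 u‖ = 1) (hpos : ∀ p ∈ S, 0 < p.1)
    (c₀ : ℂ) (c : ℝ × (Kˣ →* ℂ) → ℂ) {δ : ℝ} (hδ : 0 < δ)
    (h : ∀ t : Kˣ, ‖(t : K)‖ < δ → c₀ + ∑ p ∈ S, c p * (((‖(t : K)‖ ^ (-p.1) : ℝ)) : ℂ) * p.2 t = 0) :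
    c₀ = 0 ∧ ∀ p ∈ S, c p = 0 := by
  classical
  -- adjoin the constant as the pair `(0, 1)`
  have h01 : ((0 : ℝ), (1 : Kˣ →* ℂ)) ∉ S := fun hm => lt_irrefl (0 : ℝ) (hpos _ hm)
  set c' : ℝ × (Kˣ →* ℂ) → ℂ := fun p => if p = ((0 : ℝ), (1 : Kˣ →* ℂ)) then c₀ else c p with hc'
  have hS' : ∀ p ∈ insert ((0 : ℝ), (1 : Kˣ →* ℂ)) S, ∀ u, ‖p.2 u‖ = 1 := by
    intro p hp u
    rcases Finset.mem_insert.1 hp with rfl | hp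
    · simp
    · exact hS p hp u
  have hev : ∀ᶠ t : Kˣ in comap ((↑) : Kˣ → K) (𝓝[≠] (0 : K)),
      ∑ p ∈ insert ((0 : ℝ), (1 : Kˣ →* ℂ)) S, c' p * (((‖(t : K)‖ ^ (-p.1) : ℝ)) : ℂ) * p.2 t = 0 := by
    have hmem : {t : Kˣ | ‖(t : K)‖ < δ} ∈ comap ((↑) : Kˣ → K) (𝓝[≠] (0 : K)) := by
      have hb : Metric.ball (0 : K) δ ∈ 𝓝[≠] (0 : K) := mem_nhdsWithin_of_mem_nhds (Metric.ball_mem_nhds 0 hδ)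
      refine mem_comap.2 ⟨Metric.ball (0 : K) δ, hb, fun t ht => ?_⟩
      simpa using ht
    filter_upwards [hmem] with t ht
    rw [Finset.sum_insert h01]
    have e0 : c' ((0 : ℝ), (1 : Kˣ →* ℂ)) * (((‖(t : K)‖ ^ (-(0 : ℝ)) : ℝ)) : ℂ) * (1 : Kˣ →* ℂ) t = c₀ := by
      simp [hc']
    have eS : ∑ p ∈ S, c' p * (((‖(t : K)‖ ^ (-p.1) : ℝ)) : ℂ) * p.2 t = ∑ p ∈ S, c p * (((‖(t : K)‖ ^ (-p.1) : ℝ)) : ℂ) * p.2 t := by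
      refine Finset.sum_congr rfl fun p hp => ?_
      have hp' : p ≠ ((0 : ℝ), (1 : Kˣ →* ℂ)) := fun he => h01 (he ▸ hp)
      simp [hc', hp']
    rw [e0, eS]
    exact h t ht
  have hz := eq_zero_of_eventually_sum_rpow_mul_character_eq_zero (insert ((0 : ℝ), (1 : Kˣ →* ℂ)) S) hS' c' hev
  refine ⟨?_, fun p hp => ?_⟩
  · have := hz _ (Finset.mem_insert_self _ _)
    simpa [hc'] using this
  · have hp' : p ≠ ((0 : ℝ), (1 : Kˣ →* ℂ)) := fun he => h01 (he ▸ hp)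
    have := hz p (Finset.mem_insert_of_mem hp)
    simpa [hc', hp'] using this

end Germs

end Summit.HodgeConjecture.HodgeConjecture.Cruxes.H413.K2E4GermFunctionsLinearIndependent

end
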